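import Summits.MatrixMultiplication.MatrixMultiplication.Theorems.ThinPackings.Negative.ThinPackingsPacking

/-!
# The "genuinely thin" repair of `ThinBlockAlpha.ThinPackings` is still `X_C` in costume
(crux stmt-MatrixMultiplication-10595, negative side, IV)

The obvious repair of the crux after the costume theorem (`ThinPackingsIffCThesis.lean`: square
blocks `M = N` are allowed by `N^a ≤ M`) is to force the middle leg to be genuinely short,
`N^a ≤ M ≤ N^{a+η}`.  This file shows the repair changes nothing at the level of the full
statement: square near-tight abelian STPP packings (equivalently `X_C`, stmt-0593) already give
GENUINELY thin packings at every `(a, η)`, by powering the square family up (`AddSimultaneousTPP.pi`,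
same slack) and multiplying it with ONE exact split block `⟨m, 1, m⟩` in `(ℤ/m)²`
(`AddSimultaneousTPP.prod`), `m = ⌊ν^{(1−a)/a}⌋` where `ν` is the (large) side: blocks
`⟨νm, ν, νm⟩`, `(νm)^a ≤ ν ≤ (νm)^{a+η}`, host `|H|·m² ≤ L ν^{2+η} m² ≤ L (νm)^{2+η}`.
With `GenuinelyThin ⟹ ThinPackings ⟹ X_C` (trivial; `ThinPackingsIffCThesis.lean`) this is
`¬ GenuinelyThin ↔ ¬ X_C`.  Negative form only (refuter's lane).
-/

namespace Summit.MatrixMultiplication.MatrixMultiplication.Theorems.ThinPackings.Negative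

open Literature.Computability.AlgebraicComplexity Finset
open Literature.Combinatorics.Additive (AddSimultaneousTPP)

/-- The exact split block `⟨m, 1, m⟩` in `(ℤ/m)²`: `A = ℤ/m × 0`, `B = {0}`, `C = 0 × ℤ/m`
(a TPP triple filling its host exactly). [small model; folklore] -/
theorem split_block_two (m : ℕ) [NeZero m] :
    ∃ (A B C : Fin 1 → Finset (ZMod m × ZMod m)), IsSTPP A B C ∧
      (∀ i, (A i).card = m ∧ (B i).card = 1 ∧ (C i).card = m) := by
  refine ⟨fun _ => univ.image fun x : ZMod m => ((x, 0) : ZMod m × ZMod m), fun _ => {(0, 0)},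
    fun _ => univ.image fun y : ZMod m => ((0, y) : ZMod m × ZMod m), ?_, fun i => ?_⟩
  · intro i j k s hs s' hs' t ht t' ht' u hu u' hu' h0
    simp only [mem_image, mem_univ, true_and, mem_singleton] at hs hs' ht ht' hu hu'
    obtain ⟨x, rfl⟩ := hs; obtain ⟨x', rfl⟩ := hs'
    subst ht ht'
    obtain ⟨y, rfl⟩ := hu; obtain ⟨y', rfl⟩ := hu'
    have h1 : x' = x := by
      have := congr_arg Prod.fst h0
      simpa [sub_eq_zero] using this
    have h2 : y' = y := by
      have := congr_arg Prod.snd h0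
      simpa [sub_eq_zero] using this
    exact ⟨Subsingleton.elim _ _, Subsingleton.elim _ _, by rw [h1], rfl, by rw [h2]⟩
  · refine ⟨?_, card_singleton _, ?_⟩ <;>
      rw [card_image_of_injective _ (by intro a b h; simpa using h), card_univ, ZMod.card]

/-- **Square near-tight packings give GENUINELY thin packings** (negative form): if the
repaired crux `GenuinelyThin` (`N^a ≤ M ≤ N^{a+η}` for all `0 ≤ a < 1`, `η > 0`) fails, then
there are no square near-tight abelian STPP packings (hence `¬ X_C`).  [new] -/
theorem not_square_of_not_genuinelyThin
    (h : ¬ ∀ a : ℝ, 0 ≤ a → a < 1 → ∀ η : ℝ, 0 < η → ∃ (H : Type) (_ : AddCommGroup H)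
      (_ : Fintype H) (L N M : ℕ) (A B C : Fin L → Finset H), IsSTPP A B C ∧
      (∀ i, (A i).card = N ∧ (B i).card = M ∧ (C i).card = N) ∧ 2 ≤ N ∧ (N : ℝ) ^ a ≤ M ∧
      (M : ℝ) ≤ (N : ℝ) ^ (a + η) ∧ (Fintype.card H : ℝ) ≤ L * (N : ℝ) ^ (2 + η)) :
    ¬ ∀ ε : ℝ, 0 < ε → ∃ (H : Type) (_ : AddCommGroup H) (_ : Fintype H) (L n : ℕ)
      (A B C : Fin L → Finset H), IsSTPP A B C ∧
      (∀ i, (A i).card = n ∧ (B i).card = n ∧ (C i).card = n) ∧ 2 ≤ n ∧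
      (Fintype.card H : ℝ) ≤ L * (n : ℝ) ^ (2 + ε) := by
  intro hsq
  apply h
  intro a ha0 ha1 η hη
  rcases ha0.eq_or_lt with hzero | ha
  · -- `a = 0`: the split block `⟨2, 1, 2⟩` in `(ℤ/2)²`
    subst hzero
    obtain ⟨A, B, C, hS, hc⟩ := split_block_two 2
    refine ⟨ZMod 2 × ZMod 2, inferInstance, inferInstance, 1, 2, 1, A, B, C, hS, hc, le_rfl,
      ?_, ?_, ?_⟩
    · simp
    · rw [zero_add]
      have : (1 : ℝ) ≤ (2 : ℝ) ^ η := Real.one_le_rpow (by norm_num) hη.le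
      simpa using this
    · have h4 : (2 : ℝ) ^ (2 : ℝ) ≤ (2 : ℝ) ^ (2 + η) :=
        Real.rpow_le_rpow_of_exponent_le (by norm_num) (by linarith)
      rw [Real.rpow_two] at h4
      have hcard : (Fintype.card (ZMod 2 × ZMod 2) : ℝ) = 4 := by
        rw [Fintype.card_prod, ZMod.card]; norm_num
      rw [hcard]; push_cast; nlinarith
  -- `0 < a < 1`: power up a square family of slack `η` and multiply with a split block
  obtain ⟨H, i1, i2, L, n, A, B, C, hS, hc, hn, hH⟩ := hsq η hη
  classical
  have hS' := (isSTPP_iff_addSimultaneousTPP A B C).1 hS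
  have hn1 : (1 : ℝ) < n := by exact_mod_cast (by omega : 1 < n)
  have hnpos : (0 : ℝ) < n := by linarith
  have hL := one_le_L hH
  have h1a : 0 < 1 - a := by linarith
  -- thresholds for the side `ν = n^k`
  set T : ℝ := max 2 (max ((2 : ℝ) ^ (a / (1 - a))) ((2 : ℝ) ^ (a * (a + η) / η))) with hT
  obtain ⟨k, hk⟩ := pow_unbounded_of_one_lt T hn1
  set ν : ℝ := (n : ℝ) ^ k with hν
  have hν2 : (2 : ℝ) < ν := lt_of_le_of_lt (le_max_left _ _) hk
  have hνpos : 0 < ν := by linarith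
  have hνA : (2 : ℝ) ^ (a / (1 - a)) < ν :=
    lt_of_le_of_lt ((le_max_left _ _).trans (le_max_right _ _)) hk
  have hνB : (2 : ℝ) ^ (a * (a + η) / η) < ν :=
    lt_of_le_of_lt ((le_max_right _ _).trans (le_max_right _ _)) hk
  -- `2 ≤ ν^{(1-a)/a}` and `2^{a+η} ≤ ν^{η/a}`
  have hexp1 : 0 < (1 - a) / a := div_pos h1a ha
  have hA1 : (2 : ℝ) ≤ ν ^ ((1 - a) / a) := by
    have h1 : ((2 : ℝ) ^ (a / (1 - a))) ^ ((1 - a) / a) ≤ ν ^ ((1 - a) / a) :=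
      Real.rpow_le_rpow (by positivity) hνA.le hexp1.le
    rw [← Real.rpow_mul (by norm_num)] at h1
    have h2 : a / (1 - a) * ((1 - a) / a) = 1 := by field_simp
    rw [h2, Real.rpow_one] at h1
    exact h1
  have hA2 : (2 : ℝ) ^ (a + η) ≤ ν ^ (η / a) := by
    have h1 : ((2 : ℝ) ^ (a * (a + η) / η)) ^ (η / a) ≤ ν ^ (η / a) :=
      Real.rpow_le_rpow (by positivity) hνB.le (by positivity)
    rw [← Real.rpow_mul (by norm_num)] at h1
    have h2 : a * (a + η) / η * (η / a) = a + η := by field_simp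
    rw [h2] at h1
    exact h1
  -- the multiplier `m`
  set m : ℕ := ⌊ν ^ ((1 - a) / a)⌋₊ with hm
  have hm_le : (m : ℝ) ≤ ν ^ ((1 - a) / a) := Nat.floor_le (by positivity)
  have hm1 : 1 ≤ m := Nat.le_floor (by simpa using (by linarith [hA1] : (1 : ℝ) ≤ ν ^ ((1 - a) / a)))
  have hm_ge : ν ^ ((1 - a) / a) / 2 ≤ m := by
    have := Nat.lt_floor_add_one (ν ^ ((1 - a) / a))
    rw [← hm] at this
    linarith
  have hmpos : (0 : ℝ) < m := by exact_mod_cast (by omega : 0 < m)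
  haveI : NeZero m := ⟨by omega⟩
  -- the family: `F^k × (split block)` in `H^k × (ℤ/m)²`
  obtain ⟨A₀, B₀, C₀, hS₀, hc₀⟩ := split_block_two m
  have hS₀' := (isSTPP_iff_addSimultaneousTPP A₀ B₀ C₀).1 hS₀
  have hpow := hS'.pi (κ := Fin k)
  have hprod := hpow.prod hS₀'
  set e := Fintype.equivFin ((Fin k → Fin L) × Fin 1) with he
  have hfin := hprod.comp e.symm.injective
  have hνnat : ((n ^ k : ℕ) : ℝ) = ν := by rw [hν]; push_cast; rfl
  have hpiA : ∀ I : Fin k → Fin L, (Fintype.piFinset fun l => A (I l)).card = n ^ k := by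
    intro I
    rw [Fintype.card_piFinset, Finset.prod_congr rfl fun l _ => (hc (I l)).1, prod_const, card_univ,
      Fintype.card_fin]
  have hpiB : ∀ I : Fin k → Fin L, (Fintype.piFinset fun l => B (I l)).card = n ^ k := by
    intro I
    rw [Fintype.card_piFinset, Finset.prod_congr rfl fun l _ => (hc (I l)).2.1, prod_const,
      card_univ, Fintype.card_fin]
  have hpiC : ∀ I : Fin k → Fin L, (Fintype.piFinset fun l => C (I l)).card = n ^ k := by
    intro I
    rw [Fintype.card_piFinset, Finset.prod_congr rfl fun l _ => (hc (I l)).2.2, prod_const,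
      card_univ, Fintype.card_fin]
  refine ⟨(Fin k → H) × (ZMod m × ZMod m), inferInstance, inferInstance,
    Fintype.card ((Fin k → Fin L) × Fin 1), n ^ k * m, n ^ k,
    fun x => (Fintype.piFinset fun l => A ((e.symm x).1 l)) ×ˢ A₀ (e.symm x).2,
    fun x => (Fintype.piFinset fun l => B ((e.symm x).1 l)) ×ˢ B₀ (e.symm x).2,
    fun x => (Fintype.piFinset fun l => C ((e.symm x).1 l)) ×ˢ C₀ (e.symm x).2,
    ?_, ?_, ?_, ?_, ?_, ?_⟩
  · exact (isSTPP_iff_addSimultaneousTPP _ _ _).2 hfin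
  · intro x
    refine ⟨?_, ?_, ?_⟩ <;>
      simp only [card_product, hpiA, hpiB, hpiC, (hc₀ _).1, (hc₀ _).2.1, (hc₀ _).2.2, mul_one]
  · -- `2 ≤ n^k * m`
    have h3 : (2 : ℝ) < ((n ^ k : ℕ) : ℝ) := by rw [hνnat]; exact hν2
    have h4 : 2 < n ^ k := by exact_mod_cast h3
    calc 2 ≤ n ^ k := h4.le
      _ = n ^ k * 1 := (mul_one _).symm
      _ ≤ n ^ k * m := Nat.mul_le_mul_left _ hm1
  · -- `(ν m)^a ≤ ν`
    push_cast
    rw [show ((n : ℝ) ^ k) = ν from rfl]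
    have h1 : ν * m ≤ ν ^ (1 / a) := by
      calc ν * m ≤ ν * ν ^ ((1 - a) / a) := by gcongr
        _ = ν ^ (1 + (1 - a) / a) := by rw [Real.rpow_add hνpos, Real.rpow_one]
        _ = ν ^ (1 / a) := by congr 1; field_simp; ring
    calc (ν * m) ^ a ≤ (ν ^ (1 / a)) ^ a := Real.rpow_le_rpow (by positivity) h1 ha.le
      _ = ν := by rw [← Real.rpow_mul hνpos.le, one_div, inv_mul_cancel₀ ha.ne', Real.rpow_one]
  · -- `ν ≤ (ν m)^{a+η}`
    push_cast
    rw [show ((n : ℝ) ^ k) = ν from rfl]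
    have haη : 0 < a + η := by linarith
    have h1 : ν ^ (1 / a) / 2 ≤ ν * m := by
      calc ν ^ (1 / a) / 2 = ν * (ν ^ ((1 - a) / a) / 2) := by
            rw [show (1 : ℝ) / a = 1 + (1 - a) / a by field_simp; ring, Real.rpow_add hνpos,
              Real.rpow_one]; ring
        _ ≤ ν * m := by gcongr
    have h2 : (ν ^ (1 / a) / 2) ^ (a + η) ≤ (ν * m) ^ (a + η) :=
      Real.rpow_le_rpow (by positivity) h1 haη.le
    refine le_trans ?_ h2
    rw [Real.div_rpow (by positivity) (by norm_num), ← Real.rpow_mul hνpos.le,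
      show 1 / a * (a + η) = 1 + η / a by
        rw [div_mul_eq_mul_div, one_mul, add_div, div_self ha.ne'], Real.rpow_add hνpos,
      Real.rpow_one,
      le_div_iff₀ (by positivity)]
    calc ν * (2 : ℝ) ^ (a + η) ≤ ν * ν ^ (η / a) := by gcongr
      _ = ν * ν ^ (η / a) := rfl
  · -- host: `|H|^k m² ≤ L^k (ν m)^{2+η}`
    have hcardG : (Fintype.card ((Fin k → H) × (ZMod m × ZMod m)) : ℝ) =
        (Fintype.card H : ℝ) ^ k * ((m : ℝ) * m) := by
      rw [Fintype.card_prod, Fintype.card_prod, Fintype.card_fun, Fintype.card_fin, ZMod.card]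
      push_cast; ring
    have hcardL : (Fintype.card ((Fin k → Fin L) × Fin 1) : ℝ) = (L : ℝ) ^ k := by
      rw [Fintype.card_prod, Fintype.card_fun, Fintype.card_fin, Fintype.card_fin,
        Fintype.card_fin]
      push_cast; ring
    rw [hcardG, hcardL]
    push_cast
    rw [show ((n : ℝ) ^ k) = ν from rfl]
    have hHk : (Fintype.card H : ℝ) ^ k ≤ (L : ℝ) ^ k * ν ^ (2 + η) := by
      calc (Fintype.card H : ℝ) ^ k ≤ ((L : ℝ) * (n : ℝ) ^ (2 + η)) ^ k :=
            pow_le_pow_left₀ (Nat.cast_nonneg _) hH k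
        _ = (L : ℝ) ^ k * ν ^ (2 + η) := by
            rw [mul_pow, hν, ← Real.rpow_natCast ((n : ℝ) ^ (2 + η)) k,
              ← Real.rpow_mul hnpos.le, mul_comm (2 + η) (k : ℝ), Real.rpow_mul hnpos.le,
              Real.rpow_natCast]
    have hm2 : (m : ℝ) * m ≤ (m : ℝ) ^ (2 + η) := by
      have hm1' : (1 : ℝ) ≤ m := by exact_mod_cast hm1
      calc (m : ℝ) * m = (m : ℝ) ^ (2 : ℝ) := by rw [Real.rpow_two]; ring
        _ ≤ (m : ℝ) ^ (2 + η) := Real.rpow_le_rpow_of_exponent_le hm1' (by linarith)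
    calc (Fintype.card H : ℝ) ^ k * ((m : ℝ) * m)
        ≤ ((L : ℝ) ^ k * ν ^ (2 + η)) * (m : ℝ) ^ (2 + η) :=
          mul_le_mul hHk hm2 (by positivity) (by positivity)
      _ = (L : ℝ) ^ k * (ν * m) ^ (2 + η) := by
          rw [Real.mul_rpow hνpos.le hmpos.le]; ring

end Summit.MatrixMultiplication.MatrixMultiplication.Theorems.ThinPackings.Negative
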